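import Mathlib

/-!
# Crux `BrascampLiebVacuumSC` (stmt-QuantumFields-16404), line `SketchIdeator1`, skeleton v8:
# helpers for the stub `stub_involutionSplit` (Cartan decomposition count `dim 𝔭 ≤ dim 𝔨 + dim 𝔞`)

Pure linear algebra in `M_N(ℂ) = Matrix (Fin N) (Fin N) ℂ`, for a matrix `P` with `P² = 1` and the conjugation
`θ X = P X P`, written as the linear map `LinearMap.mulLeftRight R (P, P)` (`R = ℝ` or `ℂ`); the eigenspaces in
a subspace `W` are `W ⊓ ker (θ - 1)` (`𝔨`-part) and `W ⊓ ker (θ + 1)` (`𝔭`-part):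

* `L = 𝔨 ⊕ 𝔭` when `θ L ⊆ L` (`finrank_pPart_add_finrank_kPart`), and the identification of the sets
  `L ∩ {P X P = ∓X}` of the stub with these submodules (`span_inter_neg_eq`, `span_inter_fix_eq`);
* a maximal abelian subspace of any real subspace (`exists_maximal_abelian`: maximal dimension ⇒ own commutant);
* the restricted-root count `two_mul_finrank_le`: if `θ` maps each member `E w` of an independent family of
  complex subspaces into `E (-w)`, then a subspace of `N = ⨆_{w ≠ 0} E w` on which `θ = -1` has at most half the
  dimension of `N` (choose one `w` from each pair `±w` by `Classical.epsilon`; `N = U ⊕ U'` accordingly, with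
  `θ U ⊆ U'`, `θ U' ⊆ U`, and the subspace is the graph `{u - θ u}` over its `U`-projection);
* the splitting `negSub_le_sup` of the `-1`-eigenspace along a `θ`-stable disjoint decomposition `E₀ ⊕ N`.

No definitions, no named facts; everything is proved. [folklore]
-/

set_option autoImplicit false

open scoped Matrix
open LinearMap (ker mulLeftRight mulLeftRight_apply)

noncomputable section

namespace Summit.QuantumFields.YangMills.Theorems.BrascampLiebVacuumSC

namespace InvolutionSplit

variable {N : ℕ}

/-! ### The conjugation `θ_P X = P X P` -/

/-- `θ_P (θ_P X) = X` when `P² = 1`. [folklore] -/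
theorem conj_conj {P : Matrix (Fin N) (Fin N) ℂ} (hP : P * P = 1) (X : Matrix (Fin N) (Fin N) ℂ) :
    P * (P * X * P) * P = X := by
  rw [← Matrix.mul_assoc, ← Matrix.mul_assoc, hP, Matrix.one_mul, Matrix.mul_assoc, hP, Matrix.mul_one]

/-- `θ_P` is injective when `P² = 1`. [folklore] -/
theorem conj_injective {P : Matrix (Fin N) (Fin N) ℂ} (hP : P * P = 1) :
    Function.Injective (mulLeftRight ℂ (P, P)) :=
  Function.Involutive.injective fun X => by rw [mulLeftRight_apply, mulLeftRight_apply, conj_conj hP]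

/-- `θ_P` preserves the complex span of a real subspace it normalises. [folklore] -/
theorem conj_mem_span {L : Submodule ℝ (Matrix (Fin N) (Fin N) ℂ)} {P : Matrix (Fin N) (Fin N) ℂ}
    (hPL : ∀ X ∈ L, P * X * P ∈ L) {Z : Matrix (Fin N) (Fin N) ℂ}
    (hZ : Z ∈ Submodule.span ℂ (L : Set (Matrix (Fin N) (Fin N) ℂ))) :
    P * Z * P ∈ Submodule.span ℂ (L : Set (Matrix (Fin N) (Fin N) ℂ)) := by
  have h : Submodule.map (mulLeftRight ℂ (P, P)) (Submodule.span ℂ (L : Set (Matrix (Fin N) (Fin N) ℂ))) ≤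
      Submodule.span ℂ (L : Set (Matrix (Fin N) (Fin N) ℂ)) :=
    (Submodule.map_span_le _ _ _).2 fun X hX => Submodule.subset_span (by
      rw [mulLeftRight_apply]; exact hPL X hX)
  simpa only [mulLeftRight_apply] using h (Submodule.mem_map_of_mem hZ)

/-! ### The `±1`-eigenspaces `W ⊓ ker (θ ∓ 1)` -/

section Eigen

variable {R : Type*} [Semiring R] [Module R ℂ] [SMulCommClass R ℂ ℂ] [IsScalarTower R ℂ ℂ]

/-- Membership in the `𝔭`-part `W ⊓ ker (θ + 1) = {X ∈ W | P X P = -X}`. [folklore] -/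
theorem mem_pPart {W : Submodule R (Matrix (Fin N) (Fin N) ℂ)} {P X : Matrix (Fin N) (Fin N) ℂ} :
    X ∈ W ⊓ ker (mulLeftRight R (P, P) + 1) ↔ X ∈ W ∧ P * X * P = -X := by
  rw [Submodule.mem_inf, LinearMap.mem_ker, LinearMap.add_apply, Module.End.one_apply,
    mulLeftRight_apply, add_eq_zero_iff_eq_neg]

/-- Membership in the `𝔨`-part `W ⊓ ker (θ - 1) = {X ∈ W | P X P = X}`. [folklore] -/
theorem mem_kPart {W : Submodule R (Matrix (Fin N) (Fin N) ℂ)} {P X : Matrix (Fin N) (Fin N) ℂ} :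
    X ∈ W ⊓ ker (mulLeftRight R (P, P) - 1) ↔ X ∈ W ∧ P * X * P = X := by
  rw [Submodule.mem_inf, LinearMap.mem_ker, LinearMap.sub_apply, Module.End.one_apply,
    mulLeftRight_apply, sub_eq_zero]

end Eigen

/-- The set `L ∩ {P X P = -X}` of the stub spans the `𝔭`-part `L ⊓ ker (θ + 1)`. [folklore] -/
theorem span_inter_neg_eq (L : Submodule ℝ (Matrix (Fin N) (Fin N) ℂ)) (P : Matrix (Fin N) (Fin N) ℂ) :
    Submodule.span ℝ ((L : Set (Matrix (Fin N) (Fin N) ℂ)) ∩ {X | P * X * P = -X}) =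
      L ⊓ ker (mulLeftRight ℝ (P, P) + 1) := by
  rw [show (L : Set (Matrix (Fin N) (Fin N) ℂ)) ∩ {X | P * X * P = -X} =
    ((L ⊓ ker (mulLeftRight ℝ (P, P) + 1) : Submodule ℝ _) : Set (Matrix (Fin N) (Fin N) ℂ)) from
    Set.ext fun X => mem_pPart.symm, Submodule.span_eq]

/-- The set `L ∩ {P X P = X}` of the stub spans the `𝔨`-part `L ⊓ ker (θ - 1)`. [folklore] -/
theorem span_inter_fix_eq (L : Submodule ℝ (Matrix (Fin N) (Fin N) ℂ)) (P : Matrix (Fin N) (Fin N) ℂ) :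
    Submodule.span ℝ ((L : Set (Matrix (Fin N) (Fin N) ℂ)) ∩ {X | P * X * P = X}) =
      L ⊓ ker (mulLeftRight ℝ (P, P) - 1) := by
  rw [show (L : Set (Matrix (Fin N) (Fin N) ℂ)) ∩ {X | P * X * P = X} =
    ((L ⊓ ker (mulLeftRight ℝ (P, P) - 1) : Submodule ℝ _) : Set (Matrix (Fin N) (Fin N) ℂ)) from
    Set.ext fun X => mem_kPart.symm, Submodule.span_eq]

/-- `𝔨 ⊓ 𝔭 = ⊥`: `P X P = X = -X` forces `X = 0`. [folklore] -/
theorem kPart_inf_pPart (L : Submodule ℝ (Matrix (Fin N) (Fin N) ℂ)) (P : Matrix (Fin N) (Fin N) ℂ) :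
    (L ⊓ ker (mulLeftRight ℝ (P, P) - 1)) ⊓ (L ⊓ ker (mulLeftRight ℝ (P, P) + 1)) = ⊥ := by
  rw [eq_bot_iff]
  rintro X ⟨hk, hp⟩
  rw [Submodule.mem_bot]
  have h : X = -X := (mem_kPart.1 hk).2.symm.trans (mem_pPart.1 hp).2
  have h2X : (2 : ℂ) • X = 0 := by
    rw [two_smul]
    nth_rewrite 2 [h]
    rw [add_neg_cancel]
  exact (smul_eq_zero.1 h2X).resolve_left two_ne_zero

/-- `𝔨 ⊔ 𝔭 = L`: `X = ½ (X + θX) + ½ (X − θX)` when `θ L ⊆ L` and `θ² = 1`. [folklore] -/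
theorem kPart_sup_pPart {L : Submodule ℝ (Matrix (Fin N) (Fin N) ℂ)} {P : Matrix (Fin N) (Fin N) ℂ}
    (hP : P * P = 1) (hPL : ∀ X ∈ L, P * X * P ∈ L) :
    (L ⊓ ker (mulLeftRight ℝ (P, P) - 1)) ⊔ (L ⊓ ker (mulLeftRight ℝ (P, P) + 1)) = L := by
  refine le_antisymm (sup_le inf_le_left inf_le_left) fun X hX => ?_
  have hθX := hPL X hX
  rw [Submodule.mem_sup]
  refine ⟨(2 : ℝ)⁻¹ • (X + P * X * P), mem_kPart.2 ⟨L.smul_mem _ (add_mem hX hθX), ?_⟩,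
    (2 : ℝ)⁻¹ • (X - P * X * P), mem_pPart.2 ⟨L.smul_mem _ (sub_mem hX hθX), ?_⟩, ?_⟩
  · rw [Matrix.mul_smul, Matrix.smul_mul, Matrix.mul_add, Matrix.add_mul, conj_conj hP, add_comm]
  · rw [Matrix.mul_smul, Matrix.smul_mul, Matrix.mul_sub, Matrix.sub_mul, conj_conj hP, ← smul_neg,
      neg_sub]
  · rw [← smul_add, add_add_sub_cancel, ← two_smul ℝ X, smul_smul, inv_mul_cancel₀ two_ne_zero, one_smul]

/-- `dim 𝔭 + dim 𝔨 = dim L`. [folklore] -/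
theorem finrank_pPart_add_finrank_kPart {L : Submodule ℝ (Matrix (Fin N) (Fin N) ℂ)}
    {P : Matrix (Fin N) (Fin N) ℂ} (hP : P * P = 1) (hPL : ∀ X ∈ L, P * X * P ∈ L) :
    Module.finrank ℝ ↥(L ⊓ ker (mulLeftRight ℝ (P, P) + 1)) +
      Module.finrank ℝ ↥(L ⊓ ker (mulLeftRight ℝ (P, P) - 1)) = Module.finrank ℝ ↥L := by
  have h := Submodule.finrank_sup_add_finrank_inf_eq (L ⊓ ker (mulLeftRight ℝ (P, P) - 1))
    (L ⊓ ker (mulLeftRight ℝ (P, P) + 1))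
  rw [kPart_sup_pPart hP hPL, kPart_inf_pPart, finrank_bot, add_zero] at h
  omega

/-! ### A maximal abelian subspace -/

/-- Every real subspace `V` of `M_N(ℂ)` contains an abelian subspace `A` (pairwise commuting elements) which
is its own commutant in `V`: take an abelian subspace of maximal dimension; an element of `V` commuting with
`A` but outside it would span, with `A`, a bigger abelian subspace. [folklore] -/
theorem exists_maximal_abelian (V : Submodule ℝ (Matrix (Fin N) (Fin N) ℂ)) :
    ∃ A : Submodule ℝ (Matrix (Fin N) (Fin N) ℂ), A ≤ V ∧ (∀ H ∈ A, ∀ H' ∈ A, H * H' = H' * H) ∧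
      ∀ X ∈ V, (∀ H ∈ A, H * X = X * H) → X ∈ A := by
  classical
  set d := Module.finrank ℝ (Matrix (Fin N) (Fin N) ℂ) with hd
  let Q : ℕ → Prop := fun n => ∃ A : Submodule ℝ (Matrix (Fin N) (Fin N) ℂ), A ≤ V ∧
    (∀ H ∈ A, ∀ H' ∈ A, H * H' = H' * H) ∧ Module.finrank ℝ ↥A = n
  have hQ0 : Q 0 := ⟨⊥, bot_le, fun H hH H' _ => by
    rw [(Submodule.mem_bot ℝ).1 hH, Matrix.zero_mul, Matrix.mul_zero], finrank_bot ℝ _⟩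
  obtain ⟨A, hAV, hAab, hAd⟩ : Q (Nat.findGreatest Q d) := Nat.findGreatest_spec (Nat.zero_le d) hQ0
  refine ⟨A, hAV, hAab, fun X hXV hXc => ?_⟩
  by_contra hXA
  have hlt : A < A ⊔ ℝ ∙ X := by
    refine lt_of_le_of_ne le_sup_left fun h => hXA ?_
    rw [h]
    exact Submodule.mem_sup_right (Submodule.mem_span_singleton_self X)
  have hab' : ∀ H ∈ A ⊔ ℝ ∙ X, ∀ H' ∈ A ⊔ ℝ ∙ X, H * H' = H' * H := by
    intro H hH H' hH'
    obtain ⟨a, ha, z, hz, rfl⟩ := Submodule.mem_sup.1 hH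
    obtain ⟨a', ha', z', hz', rfl⟩ := Submodule.mem_sup.1 hH'
    obtain ⟨c, rfl⟩ := Submodule.mem_span_singleton.1 hz
    obtain ⟨c', rfl⟩ := Submodule.mem_span_singleton.1 hz'
    simp only [Matrix.mul_add, Matrix.add_mul, Matrix.mul_smul, Matrix.smul_mul]
    rw [hAab a ha a' ha', hXc a ha, hXc a' ha']
    module
  have hle : Module.finrank ℝ ↥(A ⊔ ℝ ∙ X) ≤ Nat.findGreatest Q d :=
    Nat.le_findGreatest (Submodule.finrank_le _)
      ⟨A ⊔ ℝ ∙ X, sup_le hAV ((Submodule.span_singleton_le_iff_mem X V).2 hXV), hab', rfl⟩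
  have hlt' := Submodule.finrank_lt_finrank_of_lt hlt
  omega

/-- A non-zero real linear functional differs from its negative. [folklore] -/
theorem ne_neg_of_ne_zero {V : Type*} [AddCommGroup V] [Module ℝ V] (w : V →ₗ[ℝ] ℝ) (hw : w ≠ 0) :
    w ≠ -w := by
  intro h
  apply hw
  ext v
  have h' := LinearMap.congr_fun h v
  rw [LinearMap.neg_apply] at h'
  rw [LinearMap.zero_apply]
  linarith

/-! ### Disjoint sums and the conjugation -/

/-- In a disjoint pair of subspaces, `a + b = 0` with `a ∈ U`, `b ∈ U'` forces `a = b = 0`. [folklore] -/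
theorem eq_zero_of_add_eq_zero {U U' : Submodule ℂ (Matrix (Fin N) (Fin N) ℂ)} (h : Disjoint U U')
    {a b : Matrix (Fin N) (Fin N) ℂ} (ha : a ∈ U) (hb : b ∈ U') (hab : a + b = 0) : a = 0 ∧ b = 0 := by
  have ha' : a ∈ U' := by
    rw [eq_neg_of_add_eq_zero_left hab]
    exact U'.neg_mem hb
  have h0 : a = 0 := (Submodule.disjoint_def.1 h) a ha ha'
  refine ⟨h0, ?_⟩
  rwa [h0, zero_add] at hab

/-- If `θ` maps each `E w` into `E (-w)` and `-S ⊆ S'`, then `θ (⨆_{w ∈ S} E w) ⊆ ⨆_{w ∈ S'} E w`. [folklore] -/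
theorem conj_mem_biSup {ι : Type*} [AddCommGroup ι] {P : Matrix (Fin N) (Fin N) ℂ}
    {E : ι → Submodule ℂ (Matrix (Fin N) (Fin N) ℂ)} (hθE : ∀ w, ∀ Z ∈ E w, P * Z * P ∈ E (-w))
    {S S' : Set ι} (hSS' : ∀ w ∈ S, -w ∈ S') {Z : Matrix (Fin N) (Fin N) ℂ} (hZ : Z ∈ ⨆ w ∈ S, E w) :
    P * Z * P ∈ ⨆ w ∈ S', E w := by
  have h : Submodule.map (mulLeftRight ℂ (P, P)) (⨆ w ∈ S, E w) ≤ ⨆ w ∈ S', E w := by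
    rw [Submodule.map_iSup]
    refine iSup_le fun w => ?_
    rw [Submodule.map_iSup]
    refine iSup_le fun hw => le_trans ?_ (le_biSup E (hSS' w hw))
    rintro _ ⟨Y, hY, rfl⟩
    rw [mulLeftRight_apply]
    exact hθE w Y hY
  simpa only [mulLeftRight_apply] using h (Submodule.mem_map_of_mem hZ)

/-- **The restricted-root count.** Let `E` be an independent family of complex subspaces indexed by an
additive group in which `w ≠ -w` for `w ≠ 0`, and `P² = 1` with `θ_P (E w) ⊆ E (-w)` for all `w`. Then every
subspace `V ⊆ N := ⨆_{w ≠ 0} E w` on which `θ_P = -1` satisfies `2 dim V ≤ dim N`: choosing a representative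
`r w = r (-w) ∈ {w, -w}` of each pair and writing `N = U ⊕ U'` with `U = ⨆_{w ≠ 0, r w = w} E w`,
`U' = ⨆_{w ≠ 0, r w ≠ w} E w` (`θ U ⊆ U'`, `θ U' ⊆ U`), every `Z ∈ V` is `u − θ u` for its `U`-component `u`,
so `dim V ≤ dim U ≤ dim U'`. [folklore] -/
theorem two_mul_finrank_le {ι : Type*} [AddCommGroup ι] (h2 : ∀ w : ι, w ≠ 0 → w ≠ -w)
    {P : Matrix (Fin N) (Fin N) ℂ} (hP : P * P = 1) {E : ι → Submodule ℂ (Matrix (Fin N) (Fin N) ℂ)}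
    (hE : iSupIndep E) (hθE : ∀ w, ∀ Z ∈ E w, P * Z * P ∈ E (-w)) (V : Submodule ℂ (Matrix (Fin N) (Fin N) ℂ))
    (hV : ∀ Z ∈ V, P * Z * P = -Z) (hVN : V ≤ ⨆ w ∈ {w : ι | w ≠ 0}, E w) :
    2 * Module.finrank ℂ ↥V ≤ Module.finrank ℂ ↥(⨆ w ∈ {w : ι | w ≠ 0}, E w) := by
  -- representatives of the pairs `{w, -w}`
  obtain ⟨r, hr, hrn⟩ : ∃ r : ι → ι, (∀ w, r w = w ∨ r w = -w) ∧ ∀ w, r (-w) = r w := by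
    refine ⟨fun w => @Classical.epsilon ι ⟨w⟩ fun v => v = w ∨ v = -w,
      fun w => @Classical.epsilon_spec ι (fun v => v = w ∨ v = -w) ⟨w, Or.inl rfl⟩, fun w => ?_⟩
    show @Classical.epsilon ι ⟨-w⟩ (fun v => v = -w ∨ v = - -w) =
      @Classical.epsilon ι ⟨w⟩ fun v => v = w ∨ v = -w
    congr 1
    funext v
    rw [neg_neg, or_comm]
  have hS : {w : ι | w ≠ 0 ∧ r w = w} ∪ {w : ι | w ≠ 0 ∧ r w ≠ w} = {w : ι | w ≠ 0} := by
    ext w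
    simp only [Set.mem_union, Set.mem_setOf_eq]
    tauto
  have hθU : ∀ u ∈ ⨆ w ∈ {w : ι | w ≠ 0 ∧ r w = w}, E w,
      P * u * P ∈ ⨆ w ∈ {w : ι | w ≠ 0 ∧ r w ≠ w}, E w := fun u hu =>
    conj_mem_biSup hθE (S := {w : ι | w ≠ 0 ∧ r w = w}) (S' := {w : ι | w ≠ 0 ∧ r w ≠ w})
      (fun w hw => ⟨neg_ne_zero.2 hw.1, by rw [hrn, hw.2]; exact h2 w hw.1⟩) hu
  have hθU' : ∀ u ∈ ⨆ w ∈ {w : ι | w ≠ 0 ∧ r w ≠ w}, E w,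
      P * u * P ∈ ⨆ w ∈ {w : ι | w ≠ 0 ∧ r w = w}, E w := fun u hu =>
    conj_mem_biSup hθE (S := {w : ι | w ≠ 0 ∧ r w ≠ w}) (S' := {w : ι | w ≠ 0 ∧ r w = w})
      (fun w hw => ⟨neg_ne_zero.2 hw.1, by rw [hrn]; exact (hr w).resolve_left hw.2⟩) hu
  rw [← hS, iSup_union] at hVN ⊢
  set U := ⨆ w ∈ {w : ι | w ≠ 0 ∧ r w = w}, E w with hU
  set U' := ⨆ w ∈ {w : ι | w ≠ 0 ∧ r w ≠ w}, E w with hU'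
  have hdisj : Disjoint U U' :=
    hE.disjoint_biSup_biSup (Set.disjoint_left.2 fun _ hw hw' => hw'.2 hw.2)
  have hVle : V ≤ Submodule.map (1 - mulLeftRight ℂ (P, P)) U := by
    intro Z hZ
    obtain ⟨u, hu, u', hu', rfl⟩ := Submodule.mem_sup.1 (hVN hZ)
    have hθ := hV _ hZ
    have hsum : (u + P * u' * P) + (u' + P * u * P) = 0 := by
      calc (u + P * u' * P) + (u' + P * u * P) = P * (u + u') * P + (u + u') := by
            rw [Matrix.mul_add, Matrix.add_mul]; abel
        _ = 0 := by rw [hθ, neg_add_cancel]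
    obtain ⟨-, h2'⟩ :=
      eq_zero_of_add_eq_zero hdisj (add_mem hu (hθU' u' hu')) (add_mem hu' (hθU u hu)) hsum
    refine Submodule.mem_map.2 ⟨u, hu, ?_⟩
    rw [LinearMap.sub_apply, Module.End.one_apply, mulLeftRight_apply, eq_neg_of_add_eq_zero_left h2',
      sub_eq_add_neg]
  have h1 : Module.finrank ℂ ↥V ≤ Module.finrank ℂ ↥U :=
    (Submodule.finrank_mono hVle).trans (Submodule.finrank_map_le _ _)
  have hmaple : Submodule.map (mulLeftRight ℂ (P, P)) U ≤ U' := by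
    rintro _ ⟨u, hu, rfl⟩
    rw [mulLeftRight_apply]
    exact hθU u hu
  have h2 : Module.finrank ℂ ↥U ≤ Module.finrank ℂ ↥U' := by
    rw [(Submodule.equivMapOfInjective _ (conj_injective hP) U).finrank_eq]
    exact Submodule.finrank_mono hmaple
  have h3 : Module.finrank ℂ ↥(U ⊔ U') = Module.finrank ℂ ↥U + Module.finrank ℂ ↥U' := by
    have := Submodule.finrank_sup_add_finrank_inf_eq U U'
    rwa [disjoint_iff.1 hdisj, finrank_bot, add_zero] at this
  omega

/-- **Splitting the `-1`-eigenspace along `L_ℂ = E₀ ⊕ N`.** If `E₀`, `N` are disjoint `θ`-stable subspaces with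
`E₀ ⊔ N = L_ℂ`, then `𝔭_ℂ := L_ℂ ⊓ ker (θ + 1) ≤ (𝔭_ℂ ⊓ E₀) ⊔ (𝔭_ℂ ⊓ N)`: for `Z = Z₀ + Z₁` with `θ Z = -Z`,
`(θ Z₀ + Z₀) + (θ Z₁ + Z₁) = 0` splits. [folklore] -/
theorem pPart_le_sup {P : Matrix (Fin N) (Fin N) ℂ} {Lc : Submodule ℂ (Matrix (Fin N) (Fin N) ℂ)}
    (E₀ Nn : Submodule ℂ (Matrix (Fin N) (Fin N) ℂ)) (hdisj : Disjoint E₀ Nn) (hsup : E₀ ⊔ Nn = Lc)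
    (hθ0 : ∀ Z ∈ E₀, P * Z * P ∈ E₀) (hθN : ∀ Z ∈ Nn, P * Z * P ∈ Nn) :
    Lc ⊓ ker (mulLeftRight ℂ (P, P) + 1) ≤
      (Lc ⊓ ker (mulLeftRight ℂ (P, P) + 1) ⊓ E₀) ⊔ (Lc ⊓ ker (mulLeftRight ℂ (P, P) + 1) ⊓ Nn) := by
  intro Z hZ
  obtain ⟨hZL, hθZ⟩ := mem_pPart.1 hZ
  rw [← hsup] at hZL
  obtain ⟨Z₀, h0, Z₁, h1, rfl⟩ := Submodule.mem_sup.1 hZL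
  have hsum : (P * Z₀ * P + Z₀) + (P * Z₁ * P + Z₁) = 0 := by
    calc (P * Z₀ * P + Z₀) + (P * Z₁ * P + Z₁) = P * (Z₀ + Z₁) * P + (Z₀ + Z₁) := by
          rw [Matrix.mul_add, Matrix.add_mul]; abel
      _ = 0 := by rw [hθZ, neg_add_cancel]
  obtain ⟨e0, e1⟩ := eq_zero_of_add_eq_zero hdisj (add_mem (hθ0 _ h0) h0) (add_mem (hθN _ h1) h1) hsum
  have hZ₀L : Z₀ ∈ Lc := by
    rw [← hsup]
    exact Submodule.mem_sup_left h0
  have hZ₁L : Z₁ ∈ Lc := by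
    rw [← hsup]
    exact Submodule.mem_sup_right h1
  exact add_mem (Submodule.mem_sup_left ⟨mem_pPart.2 ⟨hZ₀L, eq_neg_of_add_eq_zero_left e0⟩, h0⟩)
    (Submodule.mem_sup_right ⟨mem_pPart.2 ⟨hZ₁L, eq_neg_of_add_eq_zero_left e1⟩, h1⟩)

end InvolutionSplit

/-- **Registered sub-goal `stub_involutionSplitCount` of `stub_involutionSplit`** (the restricted-root count
`InvolutionSplit.two_mul_finrank_le` in closed form): for an independent family `E` of complex subspaces of
`M_N(ℂ)` indexed by an additive group with `w ≠ -w` for `w ≠ 0`, and `P² = 1` with `P (E w) P ⊆ E (-w)`, every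
subspace of `⨆_{w ≠ 0} E w` on which `X ↦ P X P` is `-1` has at most half the dimension. [folklore] -/
theorem stub_involutionSplitCount :
    ∀ (N : ℕ) (ι : Type) [AddCommGroup ι], (∀ w : ι, w ≠ 0 → w ≠ -w) →
      ∀ (P : Matrix (Fin N) (Fin N) ℂ), P * P = 1 →
        ∀ (E : ι → Submodule ℂ (Matrix (Fin N) (Fin N) ℂ)), iSupIndep E →
          (∀ w, ∀ Z ∈ E w, P * Z * P ∈ E (-w)) →
          ∀ (V : Submodule ℂ (Matrix (Fin N) (Fin N) ℂ)), (∀ Z ∈ V, P * Z * P = -Z) →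
            (V ≤ ⨆ w ∈ {w : ι | w ≠ 0}, E w) →
            2 * Module.finrank ℂ ↥V ≤ Module.finrank ℂ ↥(⨆ w ∈ {w : ι | w ≠ 0}, E w) :=
  fun _ _ _ h2 _ hP _ hE hθE V hV hVN => InvolutionSplit.two_mul_finrank_le h2 hP hE hθE V hV hVN

end Summit.QuantumFields.YangMills.Theorems.BrascampLiebVacuumSC

end
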